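import Summits.QuantumFields.YangMills.Theorems.BalabanUVNodesN12MinimiserFamilyKnitRowThm1LettersAtLengthOnZOfRecord
import Summits.QuantumFields.YangMills.Theorems.BalabanUVNodesN12Thm1LettersAtLengthOfK0GridG
import HarnessLib

/-!
# BalabanUVNodes ∕ N12 — THE KNIT's (J0′) ROW OF RECORD KEYED BY NAME ON THE K0 ROAD's REGISTERED TOKENS: the grid-guarded (8)-sentence `Node00.VariationalThm1RegSepCoP7MG F 2 A‴ B₃ a₀ a₁`
# (§1) and K0⁷'s registered stub-1 text `K0V22ZDefs.Prop8StepCoPGridGAt F` (§2), plus ONE guard-generic existence ∕ uniqueness sentence in NODE 00's house shape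
# ([Balaban1985Variational] (1) p.277, (2)–(7) p.278, Thm 1 (8) p.279, Prop. 8 p.304, Sect. C (44)–(48) p.285, (81)–(83) p.290, Sect. G pp.305–307, (181) p.307, Prop. 9 (190) p.309;
# [Balaban1989LargeFieldI] (1.74) p.192, p.193 ll.14–20, Prop. 1 p.194; [Balaban1985RegularSpaces] (1.3)–(1.9) p.77; [Balaban1989LargeFieldII] p.357, (1.7)–(1.9) p.358,
# (1.12)–(1.13) p.359; [Balaban1988Convergent] (2.1)–(2.2) pp.254–255, (2.5) p.255, (2.10)–(2.13) pp.256–257, (2.17)–(2.18) p.257; [Balaban1985Averaging] (8)–(9) pp.18–19,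
# Prop. 2 (52)–(54) p.26, (122)–(126) p.36; [Balaban1987RG1] (0.1) p.251, (0.4) p.253)

Cell `pub-ymgap` (HUMAN RULINGS D-0062 ∕ D-0149), seat `pub-ymgap-dag-n12-d` g26 (R134 N12 [B15] s2 = by-name knit at the record; census item E1 = the (J0′) row; count-neutral helper of K1⁹
`stmt-QuantumFields-27364`, `--kind proof --supports … --as helper`).  THEOREMS ONLY (0 `def`, 0 `instance`, 0 `sorry`); TWO compositions BY NAME.  Eighth leaf of the junction family.

WHAT.  The (J0′) head of record — `…KnitRowThm1LettersAtLengthOnZOfRecord.exists_R_hMinRow_of_thm1LettersAtLength_alongOrbit_onZ_ofRecord` (this seat's at-length edition of the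
onZ ∕ OfRecord junction ✓p735556 → the lane's `_pos` re-key ✓p739277) — displays per instance `(Z, k)` at `(ν, Kt)` the two [15]-Theorem-1 letters `h15T` ((8)) ∕ `h15EUT` (existence ∕
uniqueness modulo tower-central gauges) over NODE 00's torus class AT THE INSTANCE's LENGTH `k`.  THIS FILE keys them on the K0 road BY NAME:
§1 `h15T` ⟸ THE GRID-GUARDED (8)-SENTENCE `Node00.VariationalThm1RegSepCoP7MG F 2 A‴(c′, c₀, c₁) B₃ a₀ a₁` — THE ANTECEDENT TEXT OF K0⁷'s REGISTERED STUB 3ᴬ′-G‴-Z and the CONSEQUENT of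
dag-n07-e's guarded bridge `variationalThm1RegSepCoP7MG_of_prop8TopStepG` from the registered stub-1 text (K0⁷ = stmt-QuantumFields-20541, skeleton V22-Z fe2ecbb43f63b100; the four-conjunct
guard `A‴` VERBATIM from `K0V22ZDefs.Prop8StepCoPGridGAt`, its floor letter renamed `c′` because the (σ)_N numerics already display a `c`) — read along the degenerate history `(M, g) := (M₁, 1)`
by `BalabanUVNodesN12Thm1LettersAtLengthOfK0GridG.thm1LetterT_atLength_of_variationalThm1RegSepCoP7MG_grid`, the guard becoming THREE DISPLAYED ROWS of this instance: numerics floor `c′ ≤ ν.M₁`,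
level guard `k + c₀ ≤ m + Kt`, granularity `L^{c₁} ∣ ν.M₁` (the fourth conjunct is the instance's own `LᵏM₁ ∣ sitesPerDir 0`); `h15EUT` ⟸ ONE existence ∕ uniqueness sentence in NODE 00's
HOUSE SHAPE under the SAME guard (the guard-generic twin of the lane's named fact `B11Thm1ExistsUniqueCoP7M.VariationalThm1EUSepCoP7M` (INTENT-3, 2026-08-29) ∕ of its `h15EU` hypothesis:
K0⁷'s binders + `0 < k'` + the antecedent `A‴ …`; a floor-free inhabitant serves it a fortiori) by `…thm1LetterEU_atLength_of_houseEUG_grid`.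
§2 THE SAME FROM K0⁷'s REGISTERED STUB-1 TEXT `K0V22ZDefs.Prop8StepCoPGridGAt F` (= the signature of `K0Skeleton13SepCoPHV22Z.stub_prop8StepCoPGridG13` at `F`, tree copy byte for byte):
the constants `(c′, c₀, c₁, B₃, a₀, a₁)` (`2L² ≤ B₃`, `0 < a₀`, `0 < a₁`) are the stub's ∃-OUTPUT, uniform in the instance; the (E∕U) sentence at those constants is the one inner antecedent;
then for every instance passing the three guard rows, the head's conclusion VERBATIM.

WHY (LOCATED typing-strength, count-neutral; bus DAGN12D-G26 STARTED ∕ INTENT-100).  The `_pos` heads and every «INHABITED BY» comment name the FLOOR-FREE fact `Node00.VariationalThm1RegSepCoP7M`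
as `h15T`'s inhabitant-to-be; but the K0 road registers the GUARDED currency only (stub 1 ⟹ `…SepCoP7MG … A‴`), and floor-free ⟹ guarded (`.toG`), not conversely: nothing registered will
ever produce the floor-free sentence, and a guarded sentence serves the torus-class letter only at lengths passing its guard.  Keying the head on the REGISTERED token therefore needs the
letters at the instance's length (the at-length editions) and displays the guard honestly as instance rows — this file.  The lane's `…KnitRowThm1NamedFactsOnZOfRecord` (floor-free NAMES,
two-name display) and this head (registered currency) sit side by side.

HONEST FRAMING ∕ LOCATED.  Compositions by name; the K0 tokens and the (E∕U) sentence are HYPOTHESES — K0⁷'s stubs OPEN (N07's Prop. 8 road); the (E∕U) sentence has NO producer in the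
tree under any guard (orphan edge N07→N12) — nothing of Bałaban's asserted; reading K0's guard-generic sentence at `g ≡ 1` is an instance of its typed generality, displayed; per-height
letters discharged (dag-n12-w6 `exists_hsurjLetters`); `δ₀`, `R`, `ρ″`, `εH` EXISTENCE constants per (instance, height) (census U4: print's volume-uniform (46)∕(83) and `k`-uniformity NOT
claimed); box scope displayed; N12 NOT discharged; K0⁷ ∕ K1⁹ NOT closed; counts unmoved (typed 28∕28 · discharged 8∕27, A 8∕28); one finite 𝕋⁴ programme at fixed `ε = L^{-K}` — R4 closes
only the conditional rung `BalabanLadder.UV`; no summit statement is proved here and NOT the Yang–Mills mass gap (Clay); nothing continuum ∕ ℝ⁴ ∕ OS.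
-/

noncomputable section

namespace Summit.QuantumFields.YangMills.BalabanUVNodes.N12MinimiserFamilyKnitRowOfK0GridGOnZOfRecord

open scoped BigOperators Matrix.Norms.L2Operator Topology
open Literature.MathematicalPhysics.QuantumFieldTheory.Balaban1983to89
open T4Continuum
open B15DeterminingSets GaugeField
open ExpMeanLog (expMeanLogSU deltaSU)
open T4AdjointCovarianceUnitary (lieSU)
open Node00
open B15Prop1AnalyticExtClause (cplxVec)
open B15Prop1ChartCalculusSU2 (E3)
open T4CubeChartGnomonic (SU2)
open B14.Eq213DetSet (Bj maxDomT)
open B14.Eq213MaximalDomains (side)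
open B14.Eq22Determines (IsBlockUnion)
open B14.Eq216Concrete (feeds)
open B5Eq118OneStroke (iterBlockOf)
open B15Eq112TorusCover (lift)
open T4AxialGaugeSmallField (boxPlaqs castSite)
open B15Prop1Carrier (plaqsInside)
open Literature.MathematicalPhysics.QuantumFieldTheory.BalabanImbrieJaffe1984to88.BIJ85Eq453GaugeField (qsstarGIter0)
open B15ShellGauge193 (shellGauge)
open B15Extension193 (extend)
open B16Sect1Backgrounds (toMS expMul)
open B15Prop1ChartSU2 (su2Chart)
open Metric (ball)
open T4AxialGaugeSmallField (boxBonds)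
open Summit.QuantumFields.YangMills.BalabanUVNodes.N12MinimiserFamilyKnitRowThm1LettersAtLengthOnZOfRecord (exists_R_hMinRow_of_thm1LettersAtLength_alongOrbit_onZ_ofRecord)
open Summit.QuantumFields.YangMills.BalabanUVNodes.N12Thm1LettersAtLengthOfK0GridG (thm1LetterT_atLength_of_variationalThm1RegSepCoP7MG_grid thm1LetterEU_atLength_of_houseEUG_grid)
open Summit.QuantumFields.YangMills.BalabanUVNodes.N07Thm1Top7FromProp8 (variationalThm1RegSepCoP7MG_of_prop8TopStepG)
open Summit.QuantumFields.YangMills.Theorems.K0V22ZDefs (Prop8StepCoPGridGAt)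

variable {F : T4Family} {k : ℕ}

/-! ## §1  The head keyed on the grid-guarded (8)-sentence (K0⁷ stub 3's antecedent ∕ N07's guarded bridge output) + ONE guard-generic (E∕U) sentence -/


/-- ★★★★★ **THE KNIT's (J0′) ROW OF RECORD, KEYED BY NAME ON THE K0 ROAD's GRID-GUARDED (8)-SENTENCE** — `…KnitRowThm1LettersAtLengthOnZOfRecord.
exists_R_hMinRow_of_thm1LettersAtLength_alongOrbit_onZ_ofRecord` with its two at-length [15] letters served BY NAME: `h15T` by `(h15 : Node00.VariationalThm1RegSepCoP7MG F 2 A‴(c′,c₀,c₁) B₃ a₀ a₁)`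
(K0⁷ stub 3ᴬ′-G‴-Z's antecedent text ∕ dag-n07-e's guarded-bridge output from the registered stub 1; guard VERBATIM from `K0V22ZDefs`, floor letter renamed `c′`) through
`thm1LetterT_atLength_of_variationalThm1RegSepCoP7MG_grid`, and `h15EUT` by ONE existence ∕ uniqueness sentence `hEU` in NODE 00's house shape under the same guard through
`thm1LetterEU_atLength_of_houseEUG_grid`.  Displayed: the record numerics (`3 ≤ d`, `k + 1 ≤ m + K`, `1 ≤ k`, `LᵏM₁ ∣ sitesPerDir 0`, `(d+14)L ≤ M₁`, `IsBlockUnion k Z`), the (σ)_N numerics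
`hkc hc hMrad hM₁`, THE THREE GUARD ROWS `c′ ≤ ν.M₁` ∕ `k + c₀ ≤ m + Kt` ∕ `L^{c₁} ∣ ν.M₁`, `h15`, `hEU`; announced `ρ″ > 0`, `εH > 0`, `δ₀ > 0`; then per window ∕ region box ∕ budget ∕
`ext` ∕ `𝓐₀` ∕ `εr` (five rows) ∕ `ε₀` (four comparability rows at `ε := 2eR`) ∕ `ρn`: `∃ R > 0, ∀ V_k, strict guard → <12Q ∕ 12X-W v11 hMin ∀-body at V_k, bound 4𝓐₀, class at εr>` — the
head's conclusion VERBATIM.  «INHABITED BY»: `h15` — OPEN = K0⁷ stmt-QuantumFields-20541's registered stub 1 `stub_prop8StepCoPGridG13` through dag-n07-e's bridge (§2 displays that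
text itself); `hEU` — OPEN, NO producer in the tree ([15] Thm 1 (E∕U), `k ≥ 1`, orphan edge N07→N12; its floor-free name is the lane's `VariationalThm1EUSepCoP7M`, which serves it a fortiori).
[cite: Balaban1985Variational, (1) p.277, (2)–(7) p.278, Thm 1 (8) p.279, p.304 lines 1–2, Sect. C (44)–(48) p.285, (81)–(83) p.290, Sect. G pp.305–307, (181) p.307, Prop. 9 (190) p.309; Balaban1989LargeFieldI, (i) p.177, (1.74) p.192, p.193 L14–20, Prop. 1 p.194; Balaban1985RegularSpaces, (1.3)–(1.9) p.77; Balaban1989LargeFieldII, (1.12)–(1.13) p.359; Balaban1988Convergent, (2.1)–(2.2) pp.254–255, (2.5) p.255, (2.10)–(2.13) pp.256–257, (2.17)–(2.18) p.257; Balaban1985Averaging, (8)–(9) pp.18–19, Prop. 2 (52)–(54) p.26, (122)–(126) p.36; Balaban1987RG1, (0.1) p.251, (0.4) p.253] -/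
theorem exists_R_hMinRow_of_variationalThm1RegSepCoP7MG_grid_alongOrbit_onZ_ofRecord (ν : Node00.Stage7Numerics) (Kt : ℕ) (hd3 : 3 ≤ (F.P Kt).d) (Z : Set (Site (F.P Kt) 0))
    (hkK : k + 1 ≤ (F.P Kt).m + (F.P Kt).K) (hk1 : 1 ≤ k) (hdiv : side (F.P Kt).L ν.M₁ k ∣ (F.P Kt).sitesPerDir 0) (hfloor : ((F.P Kt).d + 14) * (F.P Kt).L ≤ ν.M₁) (hZblk : IsBlockUnion k Z)
    -- (σ)_N OF RECORD, onZ EDITION (dag-n12-w6 g18's `N12GaugeLetterLocExplicitOnZ.exists_gaugeLetterLoc_atRecord_explicit_onZ` inside the lane's U3-onZ), instance-level NUMERICS verbatim: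
    -- NUMERICS (i): a level guard `k + c ≤ m + K` with `4d + m′ + 3 < 2·L^c` (no wrapping), and `M₁ ≥ (4d + m′)·L² + 2d·L + 12` (radii), `m′ = 3·(d·((L−1)∕2)) + 5`
    {c : ℕ} (hkc : k + c ≤ (F.P Kt).m + (F.P Kt).K) (hc : 4 * (F.P Kt).d + (3 * ((F.P Kt).d * (((F.P Kt).L - 1) / 2)) + 5) + 3 < 2 * (F.P Kt).L ^ c)
    (hMrad : (4 * (F.P Kt).d + (3 * ((F.P Kt).d * (((F.P Kt).L - 1) / 2)) + 5)) * (F.P Kt).L ^ 2 + 2 * (F.P Kt).d * (F.P Kt).L + 12 ≤ ν.M₁)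
    -- the family's support numerics: `M₁ ≥ ((d+4)L + 6)·L²`
    (hM₁ : (((F.P Kt).d + 4) * (F.P Kt).L + 6) * (F.P Kt).L ^ 2 ≤ ν.M₁)
    -- THE K0 ROAD's GRID GUARD `A‴(c′, c₀, c₁)` AT THIS INSTANCE (K0⁷ V22-Z, `K0V22ZDefs.Prop8StepCoPGridGAt`): numerics floor, level guard, granularity (the fourth conjunct is `hdiv` along `g ≡ 1`)
    {c' c₀ c₁ : ℕ} (hc' : c' ≤ ν.M₁) (hkc₀ : k + c₀ ≤ F.m + Kt) (hc₁ : F.L ^ c₁ ∣ ν.M₁)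
    {B₃ a₀ a₁ : ℝ}
    -- [15] THEOREM 1 (R) = (8): THE GRID-GUARDED SENTENCE IN NODE 00's HOUSE — K0⁷ stub 3ᴬ′-G‴-Z's antecedent text ∕ the output of dag-n07-e's `variationalThm1RegSepCoP7MG_of_prop8TopStepG` on the
    -- registered stub-1 text.  «INHABITED BY»: OPEN — K0⁷ stmt-QuantumFields-20541 (`stub_prop8StepCoPGridG13`; §2 keys on that text itself)
    (h15 : VariationalThm1RegSepCoP7MG F 2
      (fun ν M g K k _s => c' ≤ ν.M₁ ∧ k + c₀ ≤ F.m + K ∧ F.L ^ c₁ ∣ M ∧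
        ∀ i, 1 ≤ i → i ≤ k → dCubeSide (F.P K).L M (RkOfRecord (F.P K).L ν.r (g i)) i ∣ (F.P K).sitesPerDir 0) B₃ a₀ a₁)
    -- [15] THEOREM 1, EXISTENCE OF THE MINIMAL ORBIT ∕ UNIQUENESS MODULO TOWER-CENTRAL GAUGES, IN NODE 00's HOUSE SHAPE UNDER THE SAME GUARD, lengths `0 < k'` (guard-generic twin of the lane's
    -- `VariationalThm1EUSepCoP7M` ∕ of its `h15EU` hypothesis).  «INHABITED BY»: OPEN — NO producer in the tree (orphan edge N07→N12)
    (hEU : ∀ (ν' : Node00.Stage7Numerics) (M : ℕ) (g : ℕ → ℝ) (K k' : ℕ) (s : SeqOfRecord F ν' M g K k'), 0 < k' →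
      Node00.Sect2.SeqSeparated ν'.M₁ s → 0 < ν'.M₁ →
      (c' ≤ ν'.M₁ ∧ k' + c₀ ≤ F.m + K ∧ F.L ^ c₁ ∣ M ∧
        ∀ i, 1 ≤ i → i ≤ k' → dCubeSide (F.P K).L M (RkOfRecord (F.P K).L ν'.r (g i)) i ∣ (F.P K).sitesPerDir 0) →
      ∀ (ε₀ : ℝ) (δ : ℕ → ℝ), (∀ j, j ≤ k' → 0 < δ j ∧ δ j ≤ a₁ ∧ B₃ * δ j ≤ ε₀) → (∀ j, j < k' → δ j ≤ 2 * δ (j + 1)) →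
      (∀ j, j < k' → δ (j + 1) ≤ 2 * δ j) → ε₀ ≤ a₀ →
      ∀ W : MSField (F.P K) SU2,
        Node00.Sect2.DataSmall7PTop (Node00.avOfRecord F 2 K) s.Ω (Node00.suppDomOfRecord F ν' K s.Ω) k' δ W →
        (∃ U₀ : GaugeField (F.P K) 0 SU2, IsMinimizer (Node00.avOfRecord F 2 K)
            {U | (∀ j, j ≤ k' → PlaqSmallOn (Node00.Sect2.omegaPlaqsTop s.Ω (Node00.suppDomOfRecord F ν' K s.Ω) j)
                (ε₀ * (F.P K).eta j ^ 2) U) ∧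
              Node00.Sect2.CoDivClassOnTop s.Ω (Node00.suppDomOfRecord F ν' K s.Ω) k' ε₀ U}
            (genSet s.Ω k') W U₀) ∧
        ∀ U₁ U₂ : GaugeField (F.P K) 0 SU2,
          IsMinimizer (Node00.avOfRecord F 2 K)
            {U | (∀ j, j ≤ k' → PlaqSmallOn (Node00.Sect2.omegaPlaqsTop s.Ω (Node00.suppDomOfRecord F ν' K s.Ω) j)
                (ε₀ * (F.P K).eta j ^ 2) U) ∧
              Node00.Sect2.CoDivClassOnTop s.Ω (Node00.suppDomOfRecord F ν' K s.Ω) k' ε₀ U}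
            (genSet s.Ω k') W U₁ →
          IsMinimizer (Node00.avOfRecord F 2 K)
            {U | (∀ j, j ≤ k' → PlaqSmallOn (Node00.Sect2.omegaPlaqsTop s.Ω (Node00.suppDomOfRecord F ν' K s.Ω) j)
                (ε₀ * (F.P K).eta j ^ 2) U) ∧
              Node00.Sect2.CoDivClassOnTop s.Ω (Node00.suppDomOfRecord F ν' K s.Ω) k' ε₀ U}
            (genSet s.Ω k') W U₂ →
          ∃ u : GaugeTransf (F.P K) 0 SU2,
            (∀ j, j ≤ k' → ∀ b ∈ bondsOf (genSet s.Ω k' j), toMS u j b.src = toMS u j b.tgt ∧ ∀ g : SU2, toMS u j b.src * g = g * toMS u j b.src) ∧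
              gaugeAct u U₁ = U₂) :
    -- the per-height letters DISCHARGED (dag-n12-w6 `N12HsurjOfClass.exists_hsurjLetters`): the radius `ρ″` and the window tolerance `εH` announced from (instance, height) alone
    ∃ ρ'' εH : ℝ, 0 < ρ'' ∧ 0 < εH ∧
    ∃ δ₀ : ℝ, 0 < δ₀ ∧
    ∀ (Λ : Set (Site (F.P Kt) 0)) (lo hi : Fin (F.P Kt).d → ℤ) (eR : ℝ), 0 < eR →
    ∀ (n : ℕ), (∀ κ, hi κ ≤ lo κ + n) → (∀ κ, ((hi κ - lo κ + 1).toNat : ℤ) + 5 < ((F.P Kt).sitesPerDir k : ℤ)) → lo ≤ hi →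
      pts k Λ = (castSite '' Set.Icc lo hi : Set (Site (F.P Kt) k)) → (boxPlaqs (lo - 1) (hi + 1) : Set (Plaq (F.P Kt) k)) ⊆ plaqsInside (pts k Z) →
    -- THE REGION BOX of the direct road (dag-n12-w6 §7's big box): `LO ≤ lo − 1`, `hi + 1 ≤ HI`, side budget `n′ < sitesPerDir k`, its plaquettes inside `Z^{(k)}`, and BOX SCOPE: every `k`-bond inside `Z^{(k)}` is a bond of the box
    -- (= print's STANDING shape condition on the class-(i) large-field components: [Balaban1988Convergent] p.255 after (2.3) «if a component of Z_j is contained in a cube of the size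
    -- 100MR_j, then it is a rectangular parallelepiped», [Balaban1989LargeFieldI] (i) p.177 — lit-balaban ME #45∕#46; not a narrowing of print's instance family)
    ∀ (LO HI : Fin (F.P Kt).d → ℤ) (n' : ℕ), LO ≤ lo - 1 → hi + 1 ≤ HI → (∀ κ, HI κ ≤ LO κ + n') → n' < (F.P Kt).sitesPerDir k →
      (boxPlaqs LO HI : Set (Plaq (F.P Kt) k)) ⊆ plaqsInside (pts k Z) → {e : PBond (F.P Kt) k | e.src ∈ pts k Z ∧ e.tgt ∈ pts k Z} ⊆ boxBonds LO HI →
    ∀ {cE : ℝ}, 12 * ((F.P Kt).d : ℝ) * ((n : ℝ) + 2) ^ 2 ≤ cE → 6 * ((((F.P Kt).d - 1 : ℕ)) : ℝ) * (F.P Kt).L ^ k * (2 * ((cE + 1) * eR)) ≤ ρ'' →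
    ∀ (ext : GaugeField (F.P Kt) k SU2 → GaugeField (F.P Kt) k SU2), (∀ W, ext W = extend (pts k Λ) (shellGauge W lo hi) W) →
    ∀ {𝓐₀ : ℝ}, 1 < 𝓐₀ →
    ∀ (εr : ℝ), 0 < εr → 12 * ((((F.P Kt).d - 1 : ℕ)) : ℝ) * (F.P Kt).L * εr ≤ ρ'' → εr ≤ εH →
      (143 * (((((F.P Kt).d + 4 : ℕ) : ℝ)) ^ 2 / 4) ^ 2) * (2 * ((F.P Kt).L : ℝ) ^ 2 * εr) ≤ 1 / 3 →
      2 * (2 * ((F.P Kt).L : ℝ) ^ 2 * εr) ≤ 2 * deltaSU (Fin 2) / ((((F.P Kt).d + 4) * (F.P Kt).L : ℕ) : ℝ) ^ 2 →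
    -- [15]'s comparability rows at `ε := 2eR`
    ∀ {ε₀ : ℝ}, (cE + 1) * (2 * eR) ≤ a₁ → B₃ * ((cE + 1) * (2 * eR)) ≤ εr → εr < ε₀ → ε₀ ≤ a₀ →
    -- the datum bond tolerance `ρn` with U3's «`T(ρn, εr) ≤ δ₀`» row (VERBATIM)
    ∀ {ρn : ℝ}, 0 ≤ ρn →
    (max ρn ((((2 * (∑ i ∈ Finset.range (k + 1), ((F.P Kt).d * (((F.P Kt).L ^ i - 1) / 2) + 1)) + 1 +
                  (3 * ((F.P Kt).d * (((F.P Kt).L - 1) / 2)) + 5) * (F.P Kt).L ^ k : ℕ) : ℝ)) ^ 2 / 4 * (εr * (F.P Kt).eta 0 ^ 2) +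
                ((3 * ((F.P Kt).d * (((F.P Kt).L - 1) / 2)) + 5 : ℕ) : ℝ) * (6 * ((((((F.P Kt).d + 2) * (F.P Kt).L : ℕ) : ℝ) ^ 2 / 4) * (2 * (εr * (F.P Kt).L ^ 2))) * ∑ i ∈ Finset.range k, ((F.P Kt).L : ℝ) ^ i) + ((3 * ((F.P Kt).d * (((F.P Kt).L - 1) / 2)) + 5 : ℕ) : ℝ) * ρn) ≤ δ₀) →
    -- the normaliser's bond tolerance (dag-n12-w6 §7, at `ε := eR`) below the datum tolerance `ρn`
    (((F.P Kt).d : ℝ) * n' + 1) * ((((F.P Kt).d - 1 : ℕ) : ℝ) * n' * ((12 * (F.P Kt).d * (n + 2) ^ 2 + 1) * eR) + 3 * (F.P Kt).d * (n + 2) ^ 2 * eR) ≤ ρn →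
    -- NO PER-BASE-FIELD HYPOTHESIS AND NO ANTECEDENT: the knit's `hMin` ∀-body for EVERY base field of the strict guard, bound `4𝓐₀`
    ∃ R : ℝ, 0 < R ∧ ∀ Vk : GaugeField (F.P Kt) k SU2, PlaqSmallOn (plaqsInside (pts k (Z ∩ Λᶜ))) eR Vk →
      ∃ Ũ : VecField (F.P Kt) k (EuclideanSpace ℂ (Fin 3)) × VecField (F.P Kt) k (EuclideanSpace ℂ (Fin 3)) → PBond (F.P Kt) 0 → Matrix (Fin 2) (Fin 2) ℂ,
        (∀ b i j, DifferentiableOn ℂ (fun z => Ũ z b i j) (ball 0 R)) ∧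
        (∀ z ∈ ball (0 : VecField (F.P Kt) k (EuclideanSpace ℂ (Fin 3)) × VecField (F.P Kt) k (EuclideanSpace ℂ (Fin 3))) R, ∀ b i j, ‖Ũ z b i j‖ ≤ 4 * 𝓐₀) ∧
        ∀ p B' : VecField (F.P Kt) k E3, ‖p‖ < R → ‖B'‖ < R → ∃ U' : GaugeField (F.P Kt) 0 SU2,
          (∀ b, Ũ (cplxVec p, cplxVec B') b = ((U' b : SU2) : Matrix (Fin 2) (Fin 2) ℂ)) ∧
            IsMinimizer (Node00.avOfRecord F 2 Kt) (Node00.regMSCoPOfRecord F 2 {ν with εreg := εr} Kt k (maxDomT ν.M₁ Z)) (Bj ν.M₁ Z k)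
              (avgFamily (Node00.avOfRecord F 2 Kt) (qsstarGIter0 k (expMul su2Chart B' (ext (expMul su2Chart p Vk))))) U' :=
  exists_R_hMinRow_of_thm1LettersAtLength_alongOrbit_onZ_ofRecord ν Kt hd3 Z hkK hk1 hdiv hfloor hZblk hkc hc hMrad hM₁
    (thm1LetterT_atLength_of_variationalThm1RegSepCoP7MG_grid h15 ν Kt k hc' hkc₀ hc₁ hdiv)
    (thm1LetterEU_atLength_of_houseEUG_grid hEU ν Kt k hk1 hc' hkc₀ hc₁ hdiv)


/-! ## §2  The head from K0⁷'s REGISTERED stub-1 text by name -/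


/-- ★★★ **THE KNIT's (J0′) ROW OF RECORD FROM K0⁷'s REGISTERED STUB-1 TEXT** `K0V22ZDefs.Prop8StepCoPGridGAt F` — the tree copy, byte for byte, of the signature of
`K0Skeleton13SepCoPHV22Z.stub_prop8StepCoPGridG13` at `F` ([15] Prop. 8's top step at NODE 00's support domains under the grid guard `A‴`, constants ∃-bound): the stub's OWN constants
`(c′, c₀, c₁, B₃, a₀, a₁)` (`2L² ≤ B₃`, `0 < a₀`, `0 < a₁`) come out FIRST, uniform in the instance; then, GIVEN the (E∕U) sentence at those constants (the one inner antecedent; orphan), §1 for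
every `(ν, Kt, Z, k)` passing the record numerics, the (σ)_N numerics and the three guard rows — conclusion VERBATIM.  Route: `variationalThm1RegSepCoP7MG_of_prop8TopStepG` (`0 < B₃` from
`2L² ≤ B₃`) then §1.  CONDITIONAL on the stub text (K0⁷ OPEN); nothing of Bałaban's asserted.
[cite: Balaban1985Variational, Thm 1 (6)–(8) pp.278–279, Prop. 8 p.304, p.304 lines 1–2, Sect. G pp.305–307, Prop. 9 (190) p.309; Balaban1985RegularSpaces, (1.3)–(1.6) p.77; Balaban1988Convergent, (2.1) p.254, (2.5) p.255, (2.12)–(2.13) p.256, (2.17)–(2.18) p.257; Balaban1987RG1, (0.1) p.251; Balaban1989LargeFieldI, (1.74) p.192, Prop. 1 p.194; Balaban1989LargeFieldII, (1.12)–(1.13) p.359; Balaban1985Averaging, Prop. 2 (52)–(54) p.26] -/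
theorem exists_R_hMinRow_of_prop8StepCoPGridGAt_alongOrbit_onZ_ofRecord (h1 : Prop8StepCoPGridGAt F) :
    ∃ (c' c₀ c₁ : ℕ) (B₃ a₀ a₁ : ℝ), 2 * (F.L : ℝ) ^ 2 ≤ B₃ ∧ 0 < a₀ ∧ 0 < a₁ ∧
    ((∀ (ν' : Node00.Stage7Numerics) (M : ℕ) (g : ℕ → ℝ) (K k' : ℕ) (s : SeqOfRecord F ν' M g K k'), 0 < k' →
      Node00.Sect2.SeqSeparated ν'.M₁ s → 0 < ν'.M₁ →
      (c' ≤ ν'.M₁ ∧ k' + c₀ ≤ F.m + K ∧ F.L ^ c₁ ∣ M ∧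
        ∀ i, 1 ≤ i → i ≤ k' → dCubeSide (F.P K).L M (RkOfRecord (F.P K).L ν'.r (g i)) i ∣ (F.P K).sitesPerDir 0) →
      ∀ (ε₀ : ℝ) (δ : ℕ → ℝ), (∀ j, j ≤ k' → 0 < δ j ∧ δ j ≤ a₁ ∧ B₃ * δ j ≤ ε₀) → (∀ j, j < k' → δ j ≤ 2 * δ (j + 1)) →
      (∀ j, j < k' → δ (j + 1) ≤ 2 * δ j) → ε₀ ≤ a₀ →
      ∀ W : MSField (F.P K) SU2,
        Node00.Sect2.DataSmall7PTop (Node00.avOfRecord F 2 K) s.Ω (Node00.suppDomOfRecord F ν' K s.Ω) k' δ W →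
        (∃ U₀ : GaugeField (F.P K) 0 SU2, IsMinimizer (Node00.avOfRecord F 2 K)
            {U | (∀ j, j ≤ k' → PlaqSmallOn (Node00.Sect2.omegaPlaqsTop s.Ω (Node00.suppDomOfRecord F ν' K s.Ω) j)
                (ε₀ * (F.P K).eta j ^ 2) U) ∧
              Node00.Sect2.CoDivClassOnTop s.Ω (Node00.suppDomOfRecord F ν' K s.Ω) k' ε₀ U}
            (genSet s.Ω k') W U₀) ∧
        ∀ U₁ U₂ : GaugeField (F.P K) 0 SU2,
          IsMinimizer (Node00.avOfRecord F 2 K)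
            {U | (∀ j, j ≤ k' → PlaqSmallOn (Node00.Sect2.omegaPlaqsTop s.Ω (Node00.suppDomOfRecord F ν' K s.Ω) j)
                (ε₀ * (F.P K).eta j ^ 2) U) ∧
              Node00.Sect2.CoDivClassOnTop s.Ω (Node00.suppDomOfRecord F ν' K s.Ω) k' ε₀ U}
            (genSet s.Ω k') W U₁ →
          IsMinimizer (Node00.avOfRecord F 2 K)
            {U | (∀ j, j ≤ k' → PlaqSmallOn (Node00.Sect2.omegaPlaqsTop s.Ω (Node00.suppDomOfRecord F ν' K s.Ω) j)
                (ε₀ * (F.P K).eta j ^ 2) U) ∧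
              Node00.Sect2.CoDivClassOnTop s.Ω (Node00.suppDomOfRecord F ν' K s.Ω) k' ε₀ U}
            (genSet s.Ω k') W U₂ →
          ∃ u : GaugeTransf (F.P K) 0 SU2,
            (∀ j, j ≤ k' → ∀ b ∈ bondsOf (genSet s.Ω k' j), toMS u j b.src = toMS u j b.tgt ∧ ∀ g : SU2, toMS u j b.src * g = g * toMS u j b.src) ∧
              gaugeAct u U₁ = U₂) →
    ∀ (ν : Node00.Stage7Numerics) (Kt : ℕ), 3 ≤ (F.P Kt).d → ∀ (Z : Set (Site (F.P Kt) 0)) (k : ℕ),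
      k + 1 ≤ (F.P Kt).m + (F.P Kt).K → 1 ≤ k → side (F.P Kt).L ν.M₁ k ∣ (F.P Kt).sitesPerDir 0 → ((F.P Kt).d + 14) * (F.P Kt).L ≤ ν.M₁ → IsBlockUnion k Z → ∀ {c : ℕ},
      k + c ≤ (F.P Kt).m + (F.P Kt).K → 4 * (F.P Kt).d + (3 * ((F.P Kt).d * (((F.P Kt).L - 1) / 2)) + 5) + 3 < 2 * (F.P Kt).L ^ c →
      (4 * (F.P Kt).d + (3 * ((F.P Kt).d * (((F.P Kt).L - 1) / 2)) + 5)) * (F.P Kt).L ^ 2 + 2 * (F.P Kt).d * (F.P Kt).L + 12 ≤ ν.M₁ →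
      (((F.P Kt).d + 4) * (F.P Kt).L + 6) * (F.P Kt).L ^ 2 ≤ ν.M₁ →
    -- the three grid-guard rows at this instance
      c' ≤ ν.M₁ → k + c₀ ≤ F.m + Kt → F.L ^ c₁ ∣ ν.M₁ →
    -- the per-height letters DISCHARGED (dag-n12-w6 `N12HsurjOfClass.exists_hsurjLetters`): the radius `ρ″` and the window tolerance `εH` announced from (instance, height) alone
    ∃ ρ'' εH : ℝ, 0 < ρ'' ∧ 0 < εH ∧
    ∃ δ₀ : ℝ, 0 < δ₀ ∧
    ∀ (Λ : Set (Site (F.P Kt) 0)) (lo hi : Fin (F.P Kt).d → ℤ) (eR : ℝ), 0 < eR →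
    ∀ (n : ℕ), (∀ κ, hi κ ≤ lo κ + n) → (∀ κ, ((hi κ - lo κ + 1).toNat : ℤ) + 5 < ((F.P Kt).sitesPerDir k : ℤ)) → lo ≤ hi →
      pts k Λ = (castSite '' Set.Icc lo hi : Set (Site (F.P Kt) k)) → (boxPlaqs (lo - 1) (hi + 1) : Set (Plaq (F.P Kt) k)) ⊆ plaqsInside (pts k Z) →
    -- THE REGION BOX of the direct road (dag-n12-w6 §7's big box): `LO ≤ lo − 1`, `hi + 1 ≤ HI`, side budget `n′ < sitesPerDir k`, its plaquettes inside `Z^{(k)}`, and BOX SCOPE: every `k`-bond inside `Z^{(k)}` is a bond of the box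
    -- (= print's STANDING shape condition on the class-(i) large-field components: [Balaban1988Convergent] p.255 after (2.3) «if a component of Z_j is contained in a cube of the size
    -- 100MR_j, then it is a rectangular parallelepiped», [Balaban1989LargeFieldI] (i) p.177 — lit-balaban ME #45∕#46; not a narrowing of print's instance family)
    ∀ (LO HI : Fin (F.P Kt).d → ℤ) (n' : ℕ), LO ≤ lo - 1 → hi + 1 ≤ HI → (∀ κ, HI κ ≤ LO κ + n') → n' < (F.P Kt).sitesPerDir k →
      (boxPlaqs LO HI : Set (Plaq (F.P Kt) k)) ⊆ plaqsInside (pts k Z) → {e : PBond (F.P Kt) k | e.src ∈ pts k Z ∧ e.tgt ∈ pts k Z} ⊆ boxBonds LO HI →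
    ∀ {cE : ℝ}, 12 * ((F.P Kt).d : ℝ) * ((n : ℝ) + 2) ^ 2 ≤ cE → 6 * ((((F.P Kt).d - 1 : ℕ)) : ℝ) * (F.P Kt).L ^ k * (2 * ((cE + 1) * eR)) ≤ ρ'' →
    ∀ (ext : GaugeField (F.P Kt) k SU2 → GaugeField (F.P Kt) k SU2), (∀ W, ext W = extend (pts k Λ) (shellGauge W lo hi) W) →
    ∀ {𝓐₀ : ℝ}, 1 < 𝓐₀ →
    ∀ (εr : ℝ), 0 < εr → 12 * ((((F.P Kt).d - 1 : ℕ)) : ℝ) * (F.P Kt).L * εr ≤ ρ'' → εr ≤ εH →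
      (143 * (((((F.P Kt).d + 4 : ℕ) : ℝ)) ^ 2 / 4) ^ 2) * (2 * ((F.P Kt).L : ℝ) ^ 2 * εr) ≤ 1 / 3 →
      2 * (2 * ((F.P Kt).L : ℝ) ^ 2 * εr) ≤ 2 * deltaSU (Fin 2) / ((((F.P Kt).d + 4) * (F.P Kt).L : ℕ) : ℝ) ^ 2 →
    -- [15]'s comparability rows at `ε := 2eR`
    ∀ {ε₀ : ℝ}, (cE + 1) * (2 * eR) ≤ a₁ → B₃ * ((cE + 1) * (2 * eR)) ≤ εr → εr < ε₀ → ε₀ ≤ a₀ →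
    -- the datum bond tolerance `ρn` with U3's «`T(ρn, εr) ≤ δ₀`» row (VERBATIM)
    ∀ {ρn : ℝ}, 0 ≤ ρn →
    (max ρn ((((2 * (∑ i ∈ Finset.range (k + 1), ((F.P Kt).d * (((F.P Kt).L ^ i - 1) / 2) + 1)) + 1 +
                  (3 * ((F.P Kt).d * (((F.P Kt).L - 1) / 2)) + 5) * (F.P Kt).L ^ k : ℕ) : ℝ)) ^ 2 / 4 * (εr * (F.P Kt).eta 0 ^ 2) +
                ((3 * ((F.P Kt).d * (((F.P Kt).L - 1) / 2)) + 5 : ℕ) : ℝ) * (6 * ((((((F.P Kt).d + 2) * (F.P Kt).L : ℕ) : ℝ) ^ 2 / 4) * (2 * (εr * (F.P Kt).L ^ 2))) * ∑ i ∈ Finset.range k, ((F.P Kt).L : ℝ) ^ i) + ((3 * ((F.P Kt).d * (((F.P Kt).L - 1) / 2)) + 5 : ℕ) : ℝ) * ρn) ≤ δ₀) →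
    -- the normaliser's bond tolerance (dag-n12-w6 §7, at `ε := eR`) below the datum tolerance `ρn`
    (((F.P Kt).d : ℝ) * n' + 1) * ((((F.P Kt).d - 1 : ℕ) : ℝ) * n' * ((12 * (F.P Kt).d * (n + 2) ^ 2 + 1) * eR) + 3 * (F.P Kt).d * (n + 2) ^ 2 * eR) ≤ ρn →
    -- NO PER-BASE-FIELD HYPOTHESIS AND NO ANTECEDENT: the knit's `hMin` ∀-body for EVERY base field of the strict guard, bound `4𝓐₀`
    ∃ R : ℝ, 0 < R ∧ ∀ Vk : GaugeField (F.P Kt) k SU2, PlaqSmallOn (plaqsInside (pts k (Z ∩ Λᶜ))) eR Vk →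
      ∃ Ũ : VecField (F.P Kt) k (EuclideanSpace ℂ (Fin 3)) × VecField (F.P Kt) k (EuclideanSpace ℂ (Fin 3)) → PBond (F.P Kt) 0 → Matrix (Fin 2) (Fin 2) ℂ,
        (∀ b i j, DifferentiableOn ℂ (fun z => Ũ z b i j) (ball 0 R)) ∧
        (∀ z ∈ ball (0 : VecField (F.P Kt) k (EuclideanSpace ℂ (Fin 3)) × VecField (F.P Kt) k (EuclideanSpace ℂ (Fin 3))) R, ∀ b i j, ‖Ũ z b i j‖ ≤ 4 * 𝓐₀) ∧
        ∀ p B' : VecField (F.P Kt) k E3, ‖p‖ < R → ‖B'‖ < R → ∃ U' : GaugeField (F.P Kt) 0 SU2,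
          (∀ b, Ũ (cplxVec p, cplxVec B') b = ((U' b : SU2) : Matrix (Fin 2) (Fin 2) ℂ)) ∧
            IsMinimizer (Node00.avOfRecord F 2 Kt) (Node00.regMSCoPOfRecord F 2 {ν with εreg := εr} Kt k (maxDomT ν.M₁ Z)) (Bj ν.M₁ Z k)
              (avgFamily (Node00.avOfRecord F 2 Kt) (qsstarGIter0 k (expMul su2Chart B' (ext (expMul su2Chart p Vk))))) U') := by
  obtain ⟨c', c₀, c₁, B₃, a₀, a₁, hB₃, ha₀, ha₁, h8⟩ := h1
  have hL : (1 : ℝ) ≤ F.L := by exact_mod_cast F.hL.2.le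
  have hB : 0 < B₃ := lt_of_lt_of_le (by positivity) hB₃
  refine ⟨c', c₀, c₁, B₃, a₀, a₁, hB₃, ha₀, ha₁, ?_⟩
  intro hEU ν Kt hd3 Z k hkK hk1 hdiv hfloor hZblk c hkc hc hMrad hM₁ hc' hkc₀ hc₁
  exact exists_R_hMinRow_of_variationalThm1RegSepCoP7MG_grid_alongOrbit_onZ_ofRecord ν Kt hd3 Z hkK hk1 hdiv hfloor hZblk hkc hc hMrad hM₁ hc' hkc₀ hc₁
    (variationalThm1RegSepCoP7MG_of_prop8TopStepG hB h8) hEU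

end Summit.QuantumFields.YangMills.BalabanUVNodes.N12MinimiserFamilyKnitRowOfK0GridGOnZOfRecord

end
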